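import Summits.CriticalPhenomena.Ising3DConformalLimit.Theorems.EnergyNotSigmaSquaredGapForcesFarMergingScreeningDefs

/-! # Floors from the separation lemma (line `screening-form-lemma-a1` of crux `GapForcesFarMerging`,
item stmt-CriticalPhenomena-4468; helper file of the open stub `stub_floors`)

The registered theorem `floors_of_separation` reduces the currency `Floors` (octave floor and bulk floor
of the one-pinch screening ladder `A(r;m) = pinchScreen n r m = E[𝟙[e₂,dn m ∉ C]·S(C_r)]`) to the
SEPARATION LEMMA UNDER THE SCREENING TILT, event form (the analogue of the separation lemmas of
Lawler 1991, ch. 3–5): with tilted probability `≥ c` one more octave of explored duplicated cluster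
(resp. the un-pinched bulk) costs the fresh probe at most a factor `c` of screening,
`c · A(r;m) ≤ E[𝟙{c·S(C_r) ≤ S(C_{r'})} · 𝟙[e₂,dn ∉ C] · S(C_r)]`  ⟹  `c² · A(r;m) ≤ A(r';m)` (Markov).
Ingredients: the box law `P^{0,up m;∅}_{Λ_n}` is a probability measure carried by a countable set, so
every bounded functional is integrable (`floorsRed_integrable`); `0 ≤ screenWeight ≤ 1/⟨σ_{e₂}σ_{dn m}⟩_{Λ_n}`
(GKS I, `|⟨σσ⟩| ≤ 1`); `integral_mono_of_nonneg`. The separation lemma itself is NOT proved here.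
References: Lawler 1991 ch. 3 (separation lemma); ADC21 (arXiv:1912.07973) App. A. -/

noncomputable section

namespace Summit.CriticalPhenomena.Ising3DConformalLimit.EnergyNotSigmaSquaredGapForcesFarMerging

open scoped symmDiff ENNReal
open MeasureTheory Filter Finset
open Literature.Probability.LatticeModels Literature.Probability.Percolation
open Summit.CriticalPhenomena.Ising3DConformalLimit.Theorems.GapForcesFarMerging.Negative (e₁ e₂ cc2 xR up dn)
open Summit.CriticalPhenomena.Ising3DConformalLimit.GapForcesFarMergingScreening

/-! ### The box law: probability, and integrability of bounded functionals -/

/-- Every functional of the trace is a.e.-strongly measurable under the box law `P^{A,B}_{Λ_n,β}`: the law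
is a countable combination of Dirac masses (push-forward of `doubleCurrentMeasure`). [folklore] -/
theorem floorsRed_aestronglyMeasurable (f : BondConfig (Site 3) → ℝ) (n : ℕ) (β : ℝ) (A B : Finset (Site 3)) :
    AEStronglyMeasurable f (sourcedDoubleCurrentLaw 3 n β A B) := by
  unfold sourcedDoubleCurrentLaw doubleCurrentMeasure
  rw [Measure.map_sum (measurable_sourcedTrace n).aemeasurable]
  refine AEStronglyMeasurable.sum_measure fun p => ?_
  rw [Measure.map_smul, Measure.map_dirac' (measurable_sourcedTrace n)]
  exact aestronglyMeasurable_dirac.smul_measure _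

/-- A bounded functional of the trace is integrable under a finite box law. [folklore] -/
theorem floorsRed_integrable {f : BondConfig (Site 3) → ℝ} {n : ℕ} {β : ℝ} {A B : Finset (Site 3)}
    [IsFiniteMeasure (sourcedDoubleCurrentLaw 3 n β A B)] (C : ℝ) (hC : ∀ ω, |f ω| ≤ C) :
    Integrable f (sourcedDoubleCurrentLaw 3 n β A B) :=
  ⟨floorsRed_aestronglyMeasurable f n β A B,
    HasFiniteIntegral.of_bounded (C := C) (ae_of_all _ fun ω => by rw [Real.norm_eq_abs]; exact hC ω)⟩

/-- The one-strand box law `P^{{0}∆{x},∅}_{Λ_n,β_c}` is a probability measure once `x ∈ Λ_n` (`β_c(3) > 0`,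
`Z_{Λ_n}[{0,x}] > 0`, `Z_{Λ_n}[∅] > 0`). [folklore] -/
theorem floorsRed_isProbabilityMeasure {n : ℕ} {x : Site 3} (hx : x ∈ box 3 n) :
    IsProbabilityMeasure (sourcedDoubleCurrentLaw 3 n (criticalBeta 3) ({0} ∆ {x}) ∅) := by
  have hβ : 0 < criticalBeta 3 := criticalBeta_pos_holds (d := 3) (by norm_num)
  by_cases h0 : (0 : Site 3) = x
  · have he : ({0} ∆ {x} : Finset (Site 3)) = ∅ := by rw [h0, symmDiff_self, Finset.bot_eq_empty]
    rw [he]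
    exact isProbabilityMeasure_sourcedDoubleCurrentLaw hβ.le
      (currentSum_boxSources_pos 3 hβ (Finset.empty_subset _) (by simp)).ne'
      (currentSum_boxSources_pos 3 hβ (Finset.empty_subset _) (by simp)).ne'
  · have hsub : ({0} ∆ {x} : Finset (Site 3)) ⊆ box 3 n := by
      intro v hv
      rw [Finset.mem_symmDiff, Finset.mem_singleton, Finset.mem_singleton] at hv
      rcases hv with ⟨rfl, _⟩ | ⟨rfl, _⟩
      · exact zero_mem_box 3 n
      · exact hx
    have hset : ({0} ∆ {x} : Finset (Site 3)) = {0, x} := by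
      ext v
      simp only [Finset.mem_symmDiff, Finset.mem_singleton, Finset.mem_insert]
      constructor
      · rintro (⟨h, _⟩ | ⟨h, _⟩)
        · exact Or.inl h
        · exact Or.inr h
      · rintro (rfl | rfl)
        · exact Or.inl ⟨rfl, h0⟩
        · exact Or.inr ⟨rfl, fun h => h0 h.symm⟩
    have hev : Even #({0} ∆ {x} : Finset (Site 3)) := by
      rw [hset, Finset.card_pair h0]
      exact even_two
    exact isProbabilityMeasure_sourcedDoubleCurrentLaw hβ.le (currentSum_boxSources_pos 3 hβ hsub hev).ne'
      (currentSum_boxSources_pos 3 hβ (Finset.empty_subset _) (by simp)).ne'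

/-! ### `0 ≤ screenWeight ≤ 1/⟨σ_aσ_b⟩_{Λ_n}` -/

/-- GKS I for the depleted box two-point function: `0 ≤ ⟨σ_aσ_b⟩_{Λ_n∖T}` for `a, b ∈ Λ_n ∖ T`.
[cite: FriedliVelenik2017, Theorem 3.20] -/
theorem floorsRed_boxTwoPoint_nonneg {n : ℕ} {T : Finset (Site 3)} {a b : Site 3} (ha : a ∈ box 3 n \ T)
    (hb : b ∈ box 3 n \ T) : 0 ≤ boxTwoPoint n T a b := by
  -- adapted from `isingTwoPoint_free_nonneg_of_mem` (CriticalTwoPointDCPLowerTorus.lean)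
  unfold boxTwoPoint
  by_cases hab : a = b
  · subst hab; simp
  rw [isingTwoPoint_eq_isingCorr _ _ _ _ _ hab]
  refine GKSInequalities.gks_one_holds (zdGraph 3) (criticalBeta_nonneg 3) le_rfl (Or.inl rfl) ?_
  intro w hw
  simp only [Finset.mem_insert, Finset.mem_singleton] at hw
  rcases hw with rfl | rfl
  · exact ha
  · exact hb

/-- `0 ≤ S⁽ⁿ⁾_{ab}(T)` for `a, b ∈ Λ_n ∖ T`. [folklore] -/
theorem floorsRed_screening_nonneg {n : ℕ} {T : Finset (Site 3)} {a b : Site 3} (ha : a ∈ box 3 n \ T)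
    (hb : b ∈ box 3 n \ T) : 0 ≤ screening n T a b := by
  unfold screening
  refine div_nonneg (floorsRed_boxTwoPoint_nonneg ha hb) (floorsRed_boxTwoPoint_nonneg ?_ ?_)
  · exact Finset.mem_sdiff.2 ⟨(Finset.mem_sdiff.1 ha).1, Finset.notMem_empty a⟩
  · exact Finset.mem_sdiff.2 ⟨(Finset.mem_sdiff.1 hb).1, Finset.notMem_empty b⟩

/-- `|S⁽ⁿ⁾_{ab}(T)| ≤ |⟨σ_aσ_b⟩_{Λ_n}|⁻¹` (since `|⟨σ_aσ_b⟩_{Λ_n∖T}| ≤ 1`). [folklore] -/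
theorem floorsRed_abs_screening_le (n : ℕ) (T : Finset (Site 3)) (a b : Site 3) :
    |screening n T a b| ≤ |boxTwoPoint n ∅ a b|⁻¹ := by
  unfold screening
  rw [abs_div, ← one_div]
  exact div_le_div_of_nonneg_right (abs_isingTwoPoint_le_one _ _ _ _ _ _ _) (abs_nonneg _)

/-- The explored cluster is part of the full cluster: `C_r(o) ⊆ C(o)`. [folklore] -/
theorem floorsRed_innerCluster_subset {r : ℕ} {o v : Site 3} {ω : BondConfig (Site 3)}
    (hv : v ∈ innerCluster r o ω) : v ∈ openCluster ω o := by
  classical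
  unfold innerCluster at hv
  rw [Finset.mem_filter] at hv
  exact openClusterIn_subset_openCluster _ ω o hv.2

/-- `0 ≤ screenWeight` for probe points inside the box. [folklore] -/
theorem floorsRed_screenWeight_nonneg {n r : ℕ} {o a b : Site 3} (ha : a ∈ box 3 n) (hb : b ∈ box 3 n)
    (ω : BondConfig (Site 3)) : 0 ≤ screenWeight n r o a b ω := by
  unfold screenWeight
  split_ifs with h
  · exact le_rfl
  · push Not at h
    exact floorsRed_screening_nonneg
      (Finset.mem_sdiff.2 ⟨ha, fun hT => h.1 (floorsRed_innerCluster_subset hT)⟩)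
      (Finset.mem_sdiff.2 ⟨hb, fun hT => h.2 (floorsRed_innerCluster_subset hT)⟩)

/-- `|screenWeight| ≤ |⟨σ_aσ_b⟩_{Λ_n}|⁻¹`, a bound uniform in the configuration. [folklore] -/
theorem floorsRed_abs_screenWeight_le (n r : ℕ) (o a b : Site 3) (ω : BondConfig (Site 3)) :
    |screenWeight n r o a b ω| ≤ |boxTwoPoint n ∅ a b|⁻¹ := by
  unfold screenWeight
  split_ifs
  · rw [abs_zero]; exact inv_nonneg.2 (abs_nonneg _)
  · exact floorsRed_abs_screening_le n _ a b

/-! ### The Markov step -/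

/-- **Markov step**: if `c·A(r;m) ≤ E[𝟙{c·S(C_r) ≤ S(C_{r'})}·𝟙[e₂,dn∉C]·S(C_r)]` then `c²·A(r;m) ≤ A(r';m)`
(probe points and the far source inside `Λ_n`). [cite: Lawler1991, Ch. 3] -/
theorem floorsRed_step {n r r' m : ℕ} {c : ℝ} (hc : 0 < c) (hup : up m ∈ box 3 n) (he₂ : e₂ ∈ box 3 n)
    (hdn : dn m ∈ box 3 n)
    (h : c * pinchScreen n r m ≤
      ∫ ω, (if c * screenWeight n r 0 e₂ (dn m) ω ≤ screenWeight n r' 0 e₂ (dn m) ω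
          then screenWeight n r 0 e₂ (dn m) ω else 0)
        ∂(sourcedDoubleCurrentLaw 3 n (criticalBeta 3) ({0} ∆ {up m}) ∅)) :
    c * c * pinchScreen n r m ≤ pinchScreen n r' m := by
  haveI := floorsRed_isProbabilityMeasure (n := n) hup
  have hmono : ∫ ω, c * (if c * screenWeight n r 0 e₂ (dn m) ω ≤ screenWeight n r' 0 e₂ (dn m) ω
          then screenWeight n r 0 e₂ (dn m) ω else 0)
        ∂(sourcedDoubleCurrentLaw 3 n (criticalBeta 3) ({0} ∆ {up m}) ∅) ≤
      ∫ ω, screenWeight n r' 0 e₂ (dn m) ω ∂(sourcedDoubleCurrentLaw 3 n (criticalBeta 3) ({0} ∆ {up m}) ∅) := by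
    refine integral_mono_of_nonneg (ae_of_all _ fun ω => ?_)
      (floorsRed_integrable _ (floorsRed_abs_screenWeight_le n r' 0 e₂ (dn m))) (ae_of_all _ fun ω => ?_)
    · show (0 : ℝ) ≤ c * _
      refine mul_nonneg hc.le ?_
      split_ifs
      · exact floorsRed_screenWeight_nonneg he₂ hdn ω
      · exact le_rfl
    · show c * _ ≤ _
      split_ifs with hle
      · exact hle
      · rw [mul_zero]; exact floorsRed_screenWeight_nonneg he₂ hdn ω
  rw [integral_const_mul] at hmono
  calc c * c * pinchScreen n r m = c * (c * pinchScreen n r m) := by ring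
    _ ≤ _ := mul_le_mul_of_nonneg_left h hc.le
    _ ≤ _ := hmono

/-! ### The points of the configuration lie in large boxes -/

/-- For `2m + 1 ≤ n` the far ends `up m`, `dn m` and the probe `e₂` lie in `Λ_n`. [folklore] -/
theorem floorsRed_mem_box {m n : ℕ} (hn : 2 * m + 1 ≤ n) : up m ∈ box 3 n ∧ e₂ ∈ box 3 n ∧ dn m ∈ box 3 n := by
  have h1 : ((2 * m + 1 : ℕ) : ℤ) ≤ n := by exact_mod_cast hn
  push_cast at h1
  refine ⟨mem_box.2 fun i => ?_, mem_box.2 fun i => ?_, mem_box.2 fun i => ?_⟩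
  · fin_cases i
    · simp [up, xR]; omega
    · simp [up, xR]; omega
    · simp [up, xR]
  · fin_cases i
    · simp
    · simp; omega
    · simp
  · fin_cases i
    · simp [dn, xR]; omega
    · simp [dn, xR]; omega
    · simp [dn, xR]

/-- Eventually in the box size, `up m`, `e₂`, `dn m ∈ Λ_n`. [folklore] -/
theorem floorsRed_eventually_mem_box (m : ℕ) :
    ∀ᶠ n : ℕ in atTop, up m ∈ box 3 n ∧ e₂ ∈ box 3 n ∧ dn m ∈ box 3 n :=
  (eventually_ge_atTop (2 * m + 1)).mono fun _ hn => floorsRed_mem_box hn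

/-! ### The registered reduction -/

/-- **FLOORS FROM THE SEPARATION LEMMA (event form)** — registered helper of the open stub `stub_floors`.
If for some `c > 0` the one-strand box law, tilted by the screening weight `𝟙[e₂,dn m ∉ C]·S(C_{2^j})`, gives
probability `≥ c` to the SEPARATION EVENT `{c·S(C_{2^j}) ≤ S(C_{2^{j+1}})}` ("one more octave of explored
duplicated cluster costs the fresh probe at most a factor `c`"), uniformly in the octave `j ≥ j₀`, the far scale
`m ≥ 2^{j+4}` and large `n` — and likewise for the bulk event `{c·S(C_{2^k}) ≤ S(C)}`, `2^{k+3} ≤ m < 2^{k+4}` — then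
`Floors` holds with `δ = c²`. This isolates the (S)-type content of the stub: the separation lemma under the
screening tilt for a sourced duplicated current cluster on `ℤ³` (template: Lawler 1991, ch. 3). [cite: Lawler1991, Ch. 3] -/
theorem floors_of_separation : ∀ c : ℝ, 0 < c → (∀ᶠ j : ℕ in atTop, ∀ m : ℕ, 2 ^ (j + 4) ≤ m → ∀ᶠ n : ℕ in atTop, c * pinchScreen n (2 ^ j) m ≤ ∫ ω, (if c * screenWeight n (2 ^ j) 0 e₂ (dn m) ω ≤ screenWeight n (2 ^ (j + 1)) 0 e₂ (dn m) ω then screenWeight n (2 ^ j) 0 e₂ (dn m) ω else 0) ∂(sourcedDoubleCurrentLaw 3 n (criticalBeta 3) ({0} ∆ {up m}) ∅)) → (∀ᶠ k : ℕ in atTop, ∀ m : ℕ, 2 ^ (k + 3) ≤ m → m < 2 ^ (k + 4) → ∀ᶠ n : ℕ in atTop, c * pinchScreen n (2 ^ k) m ≤ ∫ ω, (if c * screenWeight n (2 ^ k) 0 e₂ (dn m) ω ≤ screenWeight n n 0 e₂ (dn m) ω then screenWeight n (2 ^ k) 0 e₂ (dn m) ω else 0) ∂(sourcedDoubleCurrentLaw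 3 n (criticalBeta 3) ({0} ∆ {up m}) ∅)) → Floors := by
  intro c hc hoct hbulk
  refine ⟨c * c, mul_pos hc hc, ?_, ?_⟩
  · filter_upwards [hoct] with j hj m hm
    filter_upwards [hj m hm, floorsRed_eventually_mem_box m] with n hn hbox
    exact floorsRed_step hc hbox.1 hbox.2.1 hbox.2.2 hn
  · filter_upwards [hbulk] with k hk m hm hm'
    filter_upwards [hk m hm hm', floorsRed_eventually_mem_box m] with n hn hbox
    exact floorsRed_step hc hbox.1 hbox.2.1 hbox.2.2 hn

end Summit.CriticalPhenomena.Ising3DConformalLimit.EnergyNotSigmaSquaredGapForcesFarMerging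

end
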